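import Literature.AlgebraicGeometry.GroupSchemes.GroupObjectLawsFromCoordinates   -- ★ p844980 (P1): law ∕ endomorphism series from coordinates
import Literature.RingTheory.FormalGroups.NilpotentEvaluationPairSubst              -- ★ p844752 (β) part 2: evaluation commutes with substitution
import Literature.RingTheory.FormalGroups.FormalOModuleBud                          -- ★ defects `commDefect` ∕ `homDefect` ∕ `addDefect` ∕ `mulDefect`
import Literature.RingTheory.FormalGroups.FormalGroupCoefficients                   -- ★ p844649: `coeff_subst_X_zero` ∕ `coeff_subst_zero_X`
import HarnessLib

/-!
# Buds from coordinates: the TRUNCATED AXIOMS of the law and endomorphism series of a group object with natural nilpotent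
# coordinates, read off the group-object axioms on points ([Tate 1967] §2.2, proof of Prop. 1 — functor-of-points form)

Topic `Literature/AlgebraicGeometry/GroupSchemes`; namespace `Literature.AlgebraicGeometry.GroupSchemes`.  THEOREMS ONLY (no definition,
no named fact, no instance, no notation, no `sorry`).  Cell `hodgecm-mathlib`, P6 «MOD programme», sub-desk F0P6d, sub-line 2
`Cruxes/HLiu418/Lines/F0_P6d_ConnectedBTDictionary.lean`, letter (HL-D) `ConnectedDimOneIsOModuleLaw` — LEAD HAND σ1 step (P2), sequel
of ★ `GroupObjectLawsFromCoordinates` (P1).  Given a group object `G` over `Spec k` with a natural coordinate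
`c R : (specOver R ⟶ G) ≃ {x : R // x ^ N = 0}`, the law series `P` (`c (f * f′) = P(c f, c f′)`) and the endomorphism series `ρ_u`
(`c (f ≫ u) = ρ_u(c f)`) of (P1) satisfy — BELOW THE BOX `N`, i.e. as congruences `↑N ≤ order (defect)` in ★ `DegreeCongruence` ∕ ★
`FormalOModuleBud` currency — every axiom of a formal module law that lives in at most TWO variables: constant and linear terms, commutativity,
the homomorphism property of `ρ_u`, additivity and multiplicativity of `u ↦ ρ_u`, `ρ_𝟙 ≡ X`, `ρ_1 ≡ 0`.  (Associativity, a three-variable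
statement, is step (P3).)  Each proof is one line of group-object algebra at the universal points of `k⟦X⟧⧸(X^N)` ∕ `k⟦X,Y⟧⧸(X^N,Y^N)`
(Mathlib `MonObj.comp_mul` ∕ `mul_comp` ∕ `one_comp`, `mul_comm` for `IsCommMonObj`) followed by ★ separation
(`coeff_eq_of_evalNilp_mk_X_eq`, `coeff_eq_of_evalNilp₂_mk_X_eq`) and the ★ (β) evaluation-vs-substitution identities.
HC_CM is proved only modulo the printed citations until rung 0 closes; nothing here is about HC.

THE PRINT.  [Tate1967] §2.2, proof of Prop. 1: the comultiplications of the layers of a connected `p`-divisible group are truncated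
formal group laws; the group axioms hold modulo the defining ideals.  [Lazard1955] §I Lemme 1: congruences modulo degree.

MAIN STATEMENTS.  §1 `natCast_le_order_of_box₂` ∕ `natCast_le_order_of_box₁` (box vanishing ⇒ `↑N ≤ order`), `evalNilp₂_zero_zero`,
`evalNilp_at_zero'`; §2 (law) **`constantCoeff_law_eq_zero`**, `coeff_law_subst_X_zero` ∕ `coeff_law_subst_zero_X` (`P(X,0) ≡ X`,
`P(0,Y) ≡ Y` below the box), **`two_le_order_law_sub`** (`P ≡ X₀ + X₁ (mod deg 2)`), **`natCast_le_order_commDefect`**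
(`[IsCommMonObj G]`); §3 (endomorphisms) `constantCoeff_endo_eq_zero`, **`natCast_le_order_homDefect`** (`[IsMonHom u]`),
**`natCast_le_order_addDefect`** (`f ≫ w = (f ≫ u) * (f ≫ v)`), **`natCast_le_order_mulDefect`** (`w = v ≫ u`),
`natCast_le_order_endo_id` (`u = 𝟙`), `natCast_le_order_endo_one` (`f ≫ u = 1`).  With (P3) associativity these are exactly the
fields of ★ `IsOModuleBud 𝒪 (N − 1) P ρ` for a ring action read through `c`, whence ★ `exists_formalOModuleLaw_of_buds`.

## References
* [Tate1967] J. T. Tate, *p-divisible groups*, Proc. Conf. Local Fields (Driebergen, 1966), Springer (1967) — §2.2, proof of Prop. 1.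
* [Lazard1955] M. Lazard, *Sur les groupes de Lie formels à un paramètre*, Bull. SMF 83 (1955) — §I, Lemme 1.
* [BourbakiAlgebraII2003] N. Bourbaki, *Algebra II*, Ch. IV §4 no. 3.
-/

noncomputable section

universe u

open AlgebraicGeometry CategoryTheory MonObj CartesianMonoidalCategory
open Literature.RingTheory.FormalGroups

namespace Literature.AlgebraicGeometry.GroupSchemes

variable {k : Type u} [CommRing k]

/-! ## §1 From box vanishing to `↑N ≤ order`; evaluation at `(0,0)` -/

/-- Coefficients vanishing on the box `d₀, d₁ < N` force `↑N ≤ order` (degree `< N` implies each exponent `< N`).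
[cite: Lazard1955, §I Lemme 1] -/
theorem natCast_le_order_of_box₂ {H : MvPowerSeries (Fin 2) k} {N : ℕ}
    (h : ∀ d : Fin 2 →₀ ℕ, d 0 < N → d 1 < N → MvPowerSeries.coeff d H = 0) : (N : ℕ∞) ≤ H.order :=
  natCast_le_order_iff.2 fun d hd =>
    h d (lt_of_le_of_lt (Finsupp.le_degree 0 d) hd) (lt_of_le_of_lt (Finsupp.le_degree 1 d) hd)

/-- One-variable version. [cite: Lazard1955, §I Lemme 1] -/
theorem natCast_le_order_of_box₁ {h : PowerSeries k} {N : ℕ} (hh : ∀ m < N, PowerSeries.coeff m h = 0) :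
    (N : ℕ∞) ≤ MvPowerSeries.order h :=
  natCast_le_order_iff.2 fun d hd => by
    rw [← PowerSeries.coeff_def (s := d) rfl]
    exact hh _ (by rw [← Finsupp.degree_single () (d ())]; rwa [Finsupp.unique_single d] at hd)

/-- `F(0,0) = F₀₀`. [cite: BourbakiAlgebraII2003, Ch. IV §4 no. 3] -/
theorem evalNilp₂_zero_zero (F : MvPowerSeries (Fin 2) k) :
    evalNilp₂ F (0 : k) 0 = MvPowerSeries.constantCoeff F := by
  rw [evalNilp₂_eq_sum F (N := 1) (M := 1) (by rw [pow_one]) (by rw [pow_one])]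
  simp [MvPowerSeries.coeff_zero_eq_constantCoeff]

/-- `h(0) = h₀`. [cite: BourbakiAlgebraII2003, Ch. IV §4 no. 3] -/
theorem evalNilp_at_zero' (h : PowerSeries k) : evalNilp h (0 : k) = PowerSeries.constantCoeff h := by
  rw [evalNilp_eq_sum h (N := 1) (by rw [pow_one]), Finset.sum_range_one, pow_zero, _root_.mul_one, PowerSeries.coeff_zero_eq_constantCoeff,
    Algebra.algebraMap_self, RingHom.id_apply]

/-- Exponents of degree `< 2` in two variables. [folklore] -/
private theorem eq_of_degree_lt_two {d : Fin 2 →₀ ℕ} (hd : d.degree < 2) :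
    d = 0 ∨ d = Finsupp.single 0 1 ∨ d = Finsupp.single 1 1 := by
  have h0 := Finsupp.le_degree 0 d
  have h1 := Finsupp.le_degree 1 d
  have hsum : d.degree = d 0 + d 1 := by
    rw [Finsupp.degree_eq_sum]; simp [Fin.sum_univ_two]
  rcases Nat.lt_or_ge (d 0) 1 with ha | ha <;> rcases Nat.lt_or_ge (d 1) 1 with hb | hb
  · left; ext i; fin_cases i <;> simp <;> omega
  · right; right; ext i; fin_cases i <;> simp <;> omega
  · right; left; ext i; fin_cases i <;> simp <;> omega
  · omega

/-! ## §2 The bud axioms of the law series -/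

section Law

variable {G : Over (Spec (.of k))} [GrpObj G] {N : ℕ}
  (c : ∀ (R : Type u) [CommRing R] [Algebra k R], (specOver (A := k) R ⟶ G) ≃ {x : R // x ^ N = 0})
  {P : MvPowerSeries (Fin 2) k}

/-- **`P(0,0) = 0`** (the unit has coordinate `0`, and `1 * 1 = 1`). [cite: Tate1967, §2.2 (proof of Prop. 1)] -/
theorem constantCoeff_law_eq_zero
    (hP : ∀ (R : Type u) [CommRing R] [Algebra k R] (f f' : specOver (A := k) R ⟶ G),
      ((c R) (f * f')).1 = evalNilp₂ P ((c R) f).1 ((c R) f').1)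
    (h1 : ∀ (R : Type u) [CommRing R] [Algebra k R], ((c R) (1 : specOver (A := k) R ⟶ G)).1 = 0) :
    MvPowerSeries.constantCoeff P = 0 := by
  have h := hP k 1 1
  rw [_root_.mul_one, h1] at h
  rw [← evalNilp₂_zero_zero P]; exact h.symm

/-- **`P(X, 0) ≡ X` below the box**: the coefficients of `P(X₀, 0)` and `X₀` agree for `d₀, d₁ < N` (from `f * 1 = f` at the universal
point). [cite: Tate1967, §2.2 (proof of Prop. 1)] -/
theorem coeff_law_subst_X_zero
    (hP : ∀ (R : Type u) [CommRing R] [Algebra k R] (f f' : specOver (A := k) R ⟶ G),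
      ((c R) (f * f')).1 = evalNilp₂ P ((c R) f).1 ((c R) f').1)
    (h1 : ∀ (R : Type u) [CommRing R] [Algebra k R], ((c R) (1 : specOver (A := k) R ⟶ G)).1 = 0)
    {d : Fin 2 →₀ ℕ} (hd0 : d 0 < N) (hd1 : d 1 < N) :
    MvPowerSeries.coeff d (P.subst ![(MvPowerSeries.X 0 : MvPowerSeries (Fin 2) k), 0]) =
      MvPowerSeries.coeff d (MvPowerSeries.X 0 : MvPowerSeries (Fin 2) k) := by
  let T := MvPowerSeries (Fin 2) k ⧸
    Ideal.span {(MvPowerSeries.X 0 : MvPowerSeries (Fin 2) k) ^ N, (MvPowerSeries.X 1) ^ N}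
  let xbar : Fin 2 → T := fun i => Ideal.Quotient.mk _ (MvPowerSeries.X i)
  have hx : ∀ i, xbar i ^ N = 0 := fun i => mk_X_pow_eq_zero₂ N i
  have hxn : ∀ i, IsNilpotent (xbar i) := fun i => ⟨N, hx i⟩
  let pt : specOver (A := k) T ⟶ G := (c T).symm ⟨xbar 0, hx 0⟩
  have hpt : ((c T) pt).1 = xbar 0 := by simp [pt]
  have h := hP T pt 1
  rw [_root_.mul_one, h1, hpt] at h
  -- `x̄₀ = P(x̄₀, 0)` read as values of two-variable series at `(x̄₀, x̄₁)`
  refine coeff_eq_of_evalNilp₂_mk_X_eq ?_ hd0 hd1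
  change evalNilp₂ (P.subst ![MvPowerSeries.X 0, 0]) (xbar 0) (xbar 1) = evalNilp₂ (MvPowerSeries.X 0) (xbar 0) (xbar 1)
  rw [evalNilp₂_subst_pair P (MvPowerSeries.constantCoeff_X 0) (map_zero _) (hxn 0) (hxn 1), evalNilp₂_X₀ (hxn 0) (hxn 1),
    evalNilp₂_zero, ← h]

/-- **`P(0, Y) ≡ Y` below the box.** [cite: Tate1967, §2.2 (proof of Prop. 1)] -/
theorem coeff_law_subst_zero_X
    (hP : ∀ (R : Type u) [CommRing R] [Algebra k R] (f f' : specOver (A := k) R ⟶ G),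
      ((c R) (f * f')).1 = evalNilp₂ P ((c R) f).1 ((c R) f').1)
    (h1 : ∀ (R : Type u) [CommRing R] [Algebra k R], ((c R) (1 : specOver (A := k) R ⟶ G)).1 = 0)
    {d : Fin 2 →₀ ℕ} (hd0 : d 0 < N) (hd1 : d 1 < N) :
    MvPowerSeries.coeff d (P.subst ![(0 : MvPowerSeries (Fin 2) k), MvPowerSeries.X 1]) =
      MvPowerSeries.coeff d (MvPowerSeries.X 1 : MvPowerSeries (Fin 2) k) := by
  let T := MvPowerSeries (Fin 2) k ⧸
    Ideal.span {(MvPowerSeries.X 0 : MvPowerSeries (Fin 2) k) ^ N, (MvPowerSeries.X 1) ^ N}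
  let xbar : Fin 2 → T := fun i => Ideal.Quotient.mk _ (MvPowerSeries.X i)
  have hx : ∀ i, xbar i ^ N = 0 := fun i => mk_X_pow_eq_zero₂ N i
  have hxn : ∀ i, IsNilpotent (xbar i) := fun i => ⟨N, hx i⟩
  let pt : specOver (A := k) T ⟶ G := (c T).symm ⟨xbar 1, hx 1⟩
  have hpt : ((c T) pt).1 = xbar 1 := by simp [pt]
  have h := hP T 1 pt
  rw [_root_.one_mul, h1, hpt] at h
  refine coeff_eq_of_evalNilp₂_mk_X_eq ?_ hd0 hd1
  change evalNilp₂ (P.subst ![0, MvPowerSeries.X 1]) (xbar 0) (xbar 1) = evalNilp₂ (MvPowerSeries.X 1) (xbar 0) (xbar 1)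
  rw [evalNilp₂_subst_pair P (map_zero _) (MvPowerSeries.constantCoeff_X 1) (hxn 0) (hxn 1), evalNilp₂_X₁ (hxn 0) (hxn 1),
    evalNilp₂_zero, ← h]

/-- **Linear coefficients: `P ≡ X₀ + X₁ (mod deg 2)`** when `2 ≤ N`. [cite: Tate1967, §2.2 (proof of Prop. 1)] -/
theorem two_le_order_law_sub
    (hP : ∀ (R : Type u) [CommRing R] [Algebra k R] (f f' : specOver (A := k) R ⟶ G),
      ((c R) (f * f')).1 = evalNilp₂ P ((c R) f).1 ((c R) f').1)
    (h1 : ∀ (R : Type u) [CommRing R] [Algebra k R], ((c R) (1 : specOver (A := k) R ⟶ G)).1 = 0) (hN : 2 ≤ N) :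
    ((2 : ℕ) : ℕ∞) ≤ (P - MvPowerSeries.X 0 - MvPowerSeries.X 1).order := by
  classical
  have hX : MvPowerSeries.coeff (Finsupp.single 0 1) P = 1 := by
    have h := coeff_law_subst_X_zero c hP h1 (d := Finsupp.single 0 1) (by simp; omega) (by simp; omega)
    rw [coeff_subst_X_zero, MvPowerSeries.coeff_X, if_pos rfl] at h
    exact h
  have hY : MvPowerSeries.coeff (Finsupp.single 1 1) P = 1 := by
    have h := coeff_law_subst_zero_X c hP h1 (d := Finsupp.single 1 1) (by simp; omega) (by simp; omega)
    rw [coeff_subst_zero_X, MvPowerSeries.coeff_X, if_pos rfl] at h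
    exact h
  have h0 := constantCoeff_law_eq_zero c hP h1
  refine natCast_le_order_iff.2 fun d hd => ?_
  have hne : (Finsupp.single (0 : Fin 2) 1 : Fin 2 →₀ ℕ) ≠ Finsupp.single 1 1 := by
    rw [Ne, Finsupp.single_eq_single_iff]; simp
  rcases eq_of_degree_lt_two hd with rfl | rfl | rfl
  · simp only [map_sub, MvPowerSeries.coeff_zero_eq_constantCoeff, h0, MvPowerSeries.constantCoeff_X, sub_zero]
  · rw [map_sub, map_sub, hX, MvPowerSeries.coeff_X, MvPowerSeries.coeff_X, if_pos rfl, if_neg hne]; ring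
  · rw [map_sub, map_sub, hY, MvPowerSeries.coeff_X, MvPowerSeries.coeff_X, if_neg hne.symm, if_pos rfl]; ring

/-- **Commutativity below the box**: for a COMMUTATIVE group object, `↑N ≤ order (P − P(X₁, X₀))` (★ `commDefect`).
[cite: Tate1967, §2.2 (proof of Prop. 1)] -/
theorem natCast_le_order_commDefect [IsCommMonObj G]
    (hP : ∀ (R : Type u) [CommRing R] [Algebra k R] (f f' : specOver (A := k) R ⟶ G),
      ((c R) (f * f')).1 = evalNilp₂ P ((c R) f).1 ((c R) f').1) :
    (N : ℕ∞) ≤ (commDefect P).order := by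
  let T := MvPowerSeries (Fin 2) k ⧸
    Ideal.span {(MvPowerSeries.X 0 : MvPowerSeries (Fin 2) k) ^ N, (MvPowerSeries.X 1) ^ N}
  let xbar : Fin 2 → T := fun i => Ideal.Quotient.mk _ (MvPowerSeries.X i)
  have hx : ∀ i, xbar i ^ N = 0 := fun i => mk_X_pow_eq_zero₂ N i
  have hxn : ∀ i, IsNilpotent (xbar i) := fun i => ⟨N, hx i⟩
  let pt : Fin 2 → (specOver (A := k) T ⟶ G) := fun i => (c T).symm ⟨xbar i, hx i⟩
  have hpt : ∀ i, ((c T) (pt i)).1 = xbar i := fun i => by simp [pt]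
  have hcomm : pt 0 * pt 1 = pt 1 * pt 0 := mul_comm _ _
  have h := hP T (pt 0) (pt 1)
  rw [hcomm, hP T (pt 1) (pt 0), hpt, hpt] at h
  refine natCast_le_order_of_box₂ fun d hd0 hd1 => ?_
  rw [commDefect, map_sub, sub_eq_zero]
  refine coeff_eq_of_evalNilp₂_mk_X_eq ?_ hd0 hd1
  change evalNilp₂ P (xbar 0) (xbar 1) = evalNilp₂ (P.subst ![MvPowerSeries.X 1, MvPowerSeries.X 0]) (xbar 0) (xbar 1)
  rw [evalNilp₂_subst_pair P (MvPowerSeries.constantCoeff_X 1) (MvPowerSeries.constantCoeff_X 0) (hxn 0) (hxn 1),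
    evalNilp₂_X₁ (hxn 0) (hxn 1), evalNilp₂_X₀ (hxn 0) (hxn 1), h]

end Law

/-! ## §3 The bud axioms of endomorphism series -/

section Endo

variable {G : Over (Spec (.of k))} [GrpObj G] {N : ℕ}
  (c : ∀ (R : Type u) [CommRing R] [Algebra k R], (specOver (A := k) R ⟶ G) ≃ {x : R // x ^ N = 0})
  {P : MvPowerSeries (Fin 2) k}

/-- **`ρ_u(0) = 0`** for `u` preserving the unit (`1 ≫ u = 1`, e.g. a homomorphism). [cite: Tate1967, §2.2 (proof of Prop. 1)] -/
theorem constantCoeff_endo_eq_zero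
    (h1 : ∀ (R : Type u) [CommRing R] [Algebra k R], ((c R) (1 : specOver (A := k) R ⟶ G)).1 = 0)
    {u : G ⟶ G} (hu : ∀ (R : Type u) [CommRing R] [Algebra k R], (1 : specOver (A := k) R ⟶ G) ≫ u = 1) {ρ : PowerSeries k}
    (hρ : ∀ (R : Type u) [CommRing R] [Algebra k R] (f : specOver (A := k) R ⟶ G), ((c R) (f ≫ u)).1 = evalNilp ρ ((c R) f).1) :
    PowerSeries.constantCoeff ρ = 0 := by
  have h := hρ k 1
  rw [hu, h1] at h
  rw [← evalNilp_at_zero' ρ]; exact h.symm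

/-- **Homomorphism axiom below the box**: for a homomorphism `u` (`(f * f′) ≫ u = (f ≫ u) * (f′ ≫ u)`), `↑N ≤ order (homDefect P ρ_u)`.
[cite: Tate1967, §2.2 (proof of Prop. 1)] -/
theorem natCast_le_order_homDefect
    (hP : ∀ (R : Type u) [CommRing R] [Algebra k R] (f f' : specOver (A := k) R ⟶ G),
      ((c R) (f * f')).1 = evalNilp₂ P ((c R) f).1 ((c R) f').1)
    (h1 : ∀ (R : Type u) [CommRing R] [Algebra k R], ((c R) (1 : specOver (A := k) R ⟶ G)).1 = 0)
    (u : G ⟶ G) [IsMonHom u] {ρ : PowerSeries k}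
    (hρ : ∀ (R : Type u) [CommRing R] [Algebra k R] (f : specOver (A := k) R ⟶ G), ((c R) (f ≫ u)).1 = evalNilp ρ ((c R) f).1) :
    (N : ℕ∞) ≤ (homDefect P ρ).order := by
  have hP0 := constantCoeff_law_eq_zero c hP h1
  have hρ0 : PowerSeries.constantCoeff ρ = 0 :=
    constantCoeff_endo_eq_zero c h1 (fun R _ _ => MonObj.one_comp u) hρ
  let T := MvPowerSeries (Fin 2) k ⧸
    Ideal.span {(MvPowerSeries.X 0 : MvPowerSeries (Fin 2) k) ^ N, (MvPowerSeries.X 1) ^ N}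
  let xbar : Fin 2 → T := fun i => Ideal.Quotient.mk _ (MvPowerSeries.X i)
  have hx : ∀ i, xbar i ^ N = 0 := fun i => mk_X_pow_eq_zero₂ N i
  have hxn : ∀ i, IsNilpotent (xbar i) := fun i => ⟨N, hx i⟩
  let pt : Fin 2 → (specOver (A := k) T ⟶ G) := fun i => (c T).symm ⟨xbar i, hx i⟩
  have hpt : ∀ i, ((c T) (pt i)).1 = xbar i := fun i => by simp [pt]
  -- `ρ(P(x̄₀,x̄₁)) = P(ρ x̄₀, ρ x̄₁)`
  have h := hρ T (pt 0 * pt 1)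
  rw [MonObj.mul_comp, hP, hρ, hρ, hP, hpt, hpt] at h
  refine natCast_le_order_of_box₂ fun d hd0 hd1 => ?_
  rw [homDefect, map_sub, sub_eq_zero]
  refine coeff_eq_of_evalNilp₂_mk_X_eq ?_ hd0 hd1
  change evalNilp₂ (PowerSeries.subst P ρ) (xbar 0) (xbar 1) =
    evalNilp₂ (P.subst ![PowerSeries.subst (MvPowerSeries.X 0 : MvPowerSeries (Fin 2) k) ρ,
      PowerSeries.subst (MvPowerSeries.X 1) ρ]) (xbar 0) (xbar 1)
  rw [evalNilp₂_powerSeries_subst hP0 ρ (hxn 0) (hxn 1),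
    evalNilp₂_subst_pair P (PowerSeries.constantCoeff_subst_eq_zero (MvPowerSeries.constantCoeff_X 0) _ hρ0)
      (PowerSeries.constantCoeff_subst_eq_zero (MvPowerSeries.constantCoeff_X 1) _ hρ0) (hxn 0) (hxn 1),
    evalNilp₂_powerSeries_subst_X₀ ρ (hxn 0) (hxn 1), evalNilp₂_powerSeries_subst_X₁ ρ (hxn 0) (hxn 1), h]

/-- **Additivity below the box**: if `w = u + v` pointwise (`f ≫ w = (f ≫ u) * (f ≫ v)`), then `↑N ≤ order (addDefect P ρ_u ρ_v ρ_w)`.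
[cite: Tate1967, §2.2 (proof of Prop. 1)] -/
theorem natCast_le_order_addDefect
    (hP : ∀ (R : Type u) [CommRing R] [Algebra k R] (f f' : specOver (A := k) R ⟶ G),
      ((c R) (f * f')).1 = evalNilp₂ P ((c R) f).1 ((c R) f').1)
    (h1 : ∀ (R : Type u) [CommRing R] [Algebra k R], ((c R) (1 : specOver (A := k) R ⟶ G)).1 = 0)
    {u v w : G ⟶ G} (huvw : ∀ (R : Type u) [CommRing R] [Algebra k R] (f : specOver (A := k) R ⟶ G), f ≫ w = (f ≫ u) * (f ≫ v))
    (hu1 : ∀ (R : Type u) [CommRing R] [Algebra k R], (1 : specOver (A := k) R ⟶ G) ≫ u = 1)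
    (hv1 : ∀ (R : Type u) [CommRing R] [Algebra k R], (1 : specOver (A := k) R ⟶ G) ≫ v = 1)
    {ρu ρv ρw : PowerSeries k}
    (hρu : ∀ (R : Type u) [CommRing R] [Algebra k R] (f : specOver (A := k) R ⟶ G), ((c R) (f ≫ u)).1 = evalNilp ρu ((c R) f).1)
    (hρv : ∀ (R : Type u) [CommRing R] [Algebra k R] (f : specOver (A := k) R ⟶ G), ((c R) (f ≫ v)).1 = evalNilp ρv ((c R) f).1)
    (hρw : ∀ (R : Type u) [CommRing R] [Algebra k R] (f : specOver (A := k) R ⟶ G), ((c R) (f ≫ w)).1 = evalNilp ρw ((c R) f).1) :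
    (N : ℕ∞) ≤ MvPowerSeries.order (addDefect P ρu ρv ρw) := by
  have hu0 := constantCoeff_endo_eq_zero c h1 hu1 hρu
  have hv0 := constantCoeff_endo_eq_zero c h1 hv1 hρv
  let T := PowerSeries k ⧸ Ideal.span {(PowerSeries.X : PowerSeries k) ^ N}
  let xbar : T := Ideal.Quotient.mk _ PowerSeries.X
  have hx : xbar ^ N = 0 := mk_X_pow_eq_zero N
  have hxn : IsNilpotent xbar := ⟨N, hx⟩
  let pt : specOver (A := k) T ⟶ G := (c T).symm ⟨xbar, hx⟩
  have hpt : ((c T) pt).1 = xbar := by simp [pt]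
  have h := hρw T pt
  rw [huvw, hP, hρu, hρv, hpt] at h
  refine natCast_le_order_of_box₁ fun m hm => ?_
  rw [addDefect, map_sub, sub_eq_zero]
  refine coeff_eq_of_evalNilp_mk_X_eq ?_ hm
  change evalNilp ρw xbar = evalNilp (P.subst ![(ρu : MvPowerSeries Unit k), ρv]) xbar
  rw [evalNilp_subst_pair P hu0 hv0 hxn, ← h]

/-- **Multiplicativity below the box**: if `w = v ≫ u` then `↑N ≤ order (mulDefect ρ_u ρ_v ρ_w)` (`ρ_w ≡ ρ_u(ρ_v)`).
[cite: Tate1967, §2.2 (proof of Prop. 1)] -/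
theorem natCast_le_order_mulDefect
    (h1 : ∀ (R : Type u) [CommRing R] [Algebra k R], ((c R) (1 : specOver (A := k) R ⟶ G)).1 = 0)
    {u v w : G ⟶ G} (hw : w = v ≫ u)
    (hv1 : ∀ (R : Type u) [CommRing R] [Algebra k R], (1 : specOver (A := k) R ⟶ G) ≫ v = 1)
    {ρu ρv ρw : PowerSeries k}
    (hρu : ∀ (R : Type u) [CommRing R] [Algebra k R] (f : specOver (A := k) R ⟶ G), ((c R) (f ≫ u)).1 = evalNilp ρu ((c R) f).1)
    (hρv : ∀ (R : Type u) [CommRing R] [Algebra k R] (f : specOver (A := k) R ⟶ G), ((c R) (f ≫ v)).1 = evalNilp ρv ((c R) f).1)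
    (hρw : ∀ (R : Type u) [CommRing R] [Algebra k R] (f : specOver (A := k) R ⟶ G), ((c R) (f ≫ w)).1 = evalNilp ρw ((c R) f).1) :
    (N : ℕ∞) ≤ MvPowerSeries.order (mulDefect ρu ρv ρw) := by
  have hv0 := constantCoeff_endo_eq_zero c h1 hv1 hρv
  let T := PowerSeries k ⧸ Ideal.span {(PowerSeries.X : PowerSeries k) ^ N}
  let xbar : T := Ideal.Quotient.mk _ PowerSeries.X
  have hx : xbar ^ N = 0 := mk_X_pow_eq_zero N
  have hxn : IsNilpotent xbar := ⟨N, hx⟩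
  let pt : specOver (A := k) T ⟶ G := (c T).symm ⟨xbar, hx⟩
  have hpt : ((c T) pt).1 = xbar := by simp [pt]
  have h := hρw T pt
  rw [hw, ← Category.assoc, hρu, hρv, hpt] at h
  refine natCast_le_order_of_box₁ fun m hm => ?_
  rw [mulDefect, map_sub, sub_eq_zero]
  refine coeff_eq_of_evalNilp_mk_X_eq ?_ hm
  change evalNilp ρw xbar = evalNilp (PowerSeries.subst ρv ρu) xbar
  rw [evalNilp_subst hv0 ρu hxn, ← h]

omit [GrpObj G] in
/-- **Identity**: if `u = 𝟙` then `ρ_u ≡ X` below the box. [cite: Tate1967, §2.2 (proof of Prop. 1)] -/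
theorem natCast_le_order_endo_id {ρ : PowerSeries k}
    (hρ : ∀ (R : Type u) [CommRing R] [Algebra k R] (f : specOver (A := k) R ⟶ G), ((c R) (f ≫ 𝟙 G)).1 = evalNilp ρ ((c R) f).1) :
    (N : ℕ∞) ≤ MvPowerSeries.order (ρ - PowerSeries.X) := by
  let T := PowerSeries k ⧸ Ideal.span {(PowerSeries.X : PowerSeries k) ^ N}
  let xbar : T := Ideal.Quotient.mk _ PowerSeries.X
  have hx : xbar ^ N = 0 := mk_X_pow_eq_zero N
  have hxn : IsNilpotent xbar := ⟨N, hx⟩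
  let pt : specOver (A := k) T ⟶ G := (c T).symm ⟨xbar, hx⟩
  have hpt : ((c T) pt).1 = xbar := by simp [pt]
  have h := hρ T pt
  rw [Category.comp_id, hpt] at h
  refine natCast_le_order_of_box₁ fun m hm => ?_
  rw [map_sub, sub_eq_zero]
  refine coeff_eq_of_evalNilp_mk_X_eq ?_ hm
  change evalNilp ρ xbar = evalNilp PowerSeries.X xbar
  rw [evalNilp_X hxn, ← h]

/-- **Trivial endomorphism**: if `u = 1` (`f ≫ u = 1`) then `ρ_u ≡ 0` below the box. [cite: Tate1967, §2.2 (proof of Prop. 1)] -/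
theorem natCast_le_order_endo_one
    (h1 : ∀ (R : Type u) [CommRing R] [Algebra k R], ((c R) (1 : specOver (A := k) R ⟶ G)).1 = 0) {u : G ⟶ G}
    (hu : ∀ (R : Type u) [CommRing R] [Algebra k R] (f : specOver (A := k) R ⟶ G), f ≫ u = 1) {ρ : PowerSeries k}
    (hρ : ∀ (R : Type u) [CommRing R] [Algebra k R] (f : specOver (A := k) R ⟶ G), ((c R) (f ≫ u)).1 = evalNilp ρ ((c R) f).1) :
    (N : ℕ∞) ≤ MvPowerSeries.order ρ := by
  let T := PowerSeries k ⧸ Ideal.span {(PowerSeries.X : PowerSeries k) ^ N}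
  let xbar : T := Ideal.Quotient.mk _ PowerSeries.X
  have hx : xbar ^ N = 0 := mk_X_pow_eq_zero N
  let pt : specOver (A := k) T ⟶ G := (c T).symm ⟨xbar, hx⟩
  have hpt : ((c T) pt).1 = xbar := by simp [pt]
  have h := hρ T pt
  rw [hu, h1, hpt] at h
  refine natCast_le_order_of_box₁ fun m hm => ?_
  refine (coeff_eq_of_evalNilp_mk_X_eq ?_ hm).trans (by rw [map_zero])
  change evalNilp ρ xbar = evalNilp (0 : PowerSeries k) xbar
  rw [evalNilp_zero, ← h]

end Endo

end Literature.AlgebraicGeometry.GroupSchemes
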